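import Summits.ResolutionOfSingularities.ResolutionOfSingularities.Theses.RadicialJung
import Summits.ResolutionOfSingularities.ResolutionOfSingularities.Theorems.RadicialJungCleanModelsStubGenerator
import Summits.ResolutionOfSingularities.ResolutionOfSingularities.Theorems.RadicialJungCleanModelsStubFrobeniusTwist
import Summits.ResolutionOfSingularities.ResolutionOfSingularities.Theorems.RadicialJungCleanModelsStubPointwiseTransfer
import Summits.ResolutionOfSingularities.ResolutionOfSingularities.Theorems.RadicialJungCleanModelsStubDvrNormalization
import Summits.ResolutionOfSingularities.ResolutionOfSingularities.Theorems.RadicialJungCleanModelsStubDvrClean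
import Summits.ResolutionOfSingularities.ResolutionOfSingularities.Theorems.RadicialJungCleanModelsStubCurveStalks
import Literature.AlgebraicGeometry.Motives.RatFnBirational
import Literature.AlgebraicGeometry.Resolution.RegularCentreBlowupSeqExtension
import HarnessLib

/-!
# Route `RadicialJung`, crux `CleanModels`: reduction to log-clean principalization, and dimension ≤ 1

Route `ResolutionOfSingularities/RadicialJung`, crux item `CleanModels`
(stmt-ResolutionOfSingularities-15917), line `Sketch` (lead prover, 2026-08-16).

`CleanModels` = LOG-CLEAN MODELS EXIST: for `p` prime, `k` any field of characteristic `p`, `W`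
regular integral separated of finite type over `k` and `L/K(W)` purely inseparable of degree `p`,
some proper birational REGULAR `π : V → W` carries at every point `v` an element `y ∈ L ∖ K(W)`,
`y^p = g`, with `π^*g` EXACTLY clean at `v`: `∏_{i<m} t_i^{a_i}` for a minimal generating system
`(t_1..t_d)` of `𝔪_v`, `d = dim 𝒪_{V,v}`, `m ≥ 1`, `p ∤ a_i` (toroidal type), or a unit `u₀` with
`(∀ c, u₀ - c^p ∉ 𝔪_v) ∨ (∃ c, u₀ - c^p ∈ 𝔪_v ∖ 𝔪_v²)` (regular type).

This file proves two things, sorry-free: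

* `cleanModels_of_logCleanPrincipalization` — **the crux reduces to LOG-CLEAN PRINCIPALIZATION**,
  an `L`-free, unit-tolerant statement about one `g₀ ∈ K(W) ∖ K(W)^p`: a proper birational regular
  `V → W` on which, at every `v`, some NON-TRIVIAL representative `Σ_{j<p} c_j^p g₀^j` of the
  `K(W)^p`-line of `g₀` (these are exactly the `p`-th powers of `L = K(W)(g₀^{1/p})` outside
  `K(W)^p`) is LOOSELY clean: `unit · ∏ t_i^{a_i}` (`p ∤ a_i`, `m ≥ 1`), or a unit residually not
  a `p`-th power, or `c^p + (regular parameter)`. This is the statement Giraud 1983 (dim 2) and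
  Cossart 1987 (dim 3) prove, and it is equivalent to the crux (the converse is immediate). The
  bookkeeping: a generator `y₀`, `y₀^p = g₀ ∉ K(W)^p` (`stub_generator`); pointwise normalisation
  of loose to exact forms by `x ↦ ε^p x + δ`, `ε` a unit, `δ ∈ {0,1}` (`stub_pointwiseTransfer`:
  unit absorption by Bézout `1 = α a₁ + β p` and the shift `+1`); transport of `ε` to `K(W)` along
  `π^♯ : K(W) ≅ K(V)`; the twisted representative is `y^p` with `y = ε Σ c_j y₀^j + δ ∉ K(W)`
  (`stub_frobeniusTwist`).
* `cleanModels_dim_le_one` — **the crux in dimension `≤ 1` with `V = W`** (route header,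
  calibration "CleanModels for dim W = 1"): at the generic point any generator is of regular type
  (i); at a closed point the stalk is a DVR `O` whose normalisation `B` in `L` is a finite
  (`stub_curveStalks`, E. Noether) DVR with `B^p ⊆ O` (`stub_dvrNormalization`), and `e f = p`
  yields a `p`-th root of a uniformizer (type (ii)) or a residually new unit (type (i))
  (`stub_dvrClean`).
-/

noncomputable section

set_option linter.dupNamespace false -- mandated namespace of this single-conjunct summit

open CategoryTheory AlgebraicGeometry TopologicalSpace
open Literature.AlgebraicGeometry.Resolution Literature.AlgebraicGeometry.Motives

namespace Summit.ResolutionOfSingularities.ResolutionOfSingularities.Theorems.RadicialJung.CleanModels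

/-! ## Glue -/

/-- The stalks of an integral scheme over a field of characteristic `p` have characteristic `p`
(they receive the field `k`). [folklore] -/
theorem charP_stalk {p : ℕ} {k : Type} [Field k] [CharP k p] (Y : Scheme.{0})
    (f : Y ⟶ Spec (.of k)) (y : Y) : CharP (Y.presheaf.stalk y) p := by
  let φ : k →+* Y.presheaf.stalk y :=
    (Y.presheaf.germ ⊤ y trivial).hom.comp ((f.appTop).hom.comp (Scheme.ΓSpecIso (.of k)).inv.hom)
  exact (φ.charP_iff_charP p).mp inferInstance

/-- **The crux reduces to log-clean principalization.** Suppose that for every prime `p`, every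
field `k` of characteristic `p`, every regular integral separated `W` of finite type over `k` and
every `g₀ ∈ K(W)` which is not a `p`-th power there is a proper birational `π : V → W` with `V`
integral and regular such that at every `v ∈ V` some non-trivial representative
`g = Σ_{j<p} c_j^p g₀^j` of the `K(W)^p`-line of `g₀` is LOOSELY clean: `π^*g = u ∏_{i<m} t_i^{a_i}`
for a minimal generating system `(t_1..t_d)` of `𝔪_v` (`d = dim 𝒪_{V,v}`), a unit `u`, `m ≥ 1`,
`p ∤ a_i`; or `π^*g = u` a unit with `∀ c, u - c^p ∉ 𝔪_v`; or `π^*g = s` with `s - c^p ∈ 𝔪_v ∖ 𝔪_v²`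
for some `c`. Then `CleanModels` holds. (Extract a generator `y₀`, `y₀^p = g₀ ∉ K(W)^p`; take the
loosely clean model for `g₀`; at each point normalise the loose form by `x ↦ ε^p x + δ`, transport
`ε` back to `K(W)` along `π^♯ : K(W) ≅ K(V)`, and realise the twisted representative as the `p`-th
power of `ε Σ c_j y₀^j + δ ∈ L ∖ K(W)`.) -/
theorem cleanModels_of_logCleanPrincipalization
    (h : ∀ (p : ℕ), p.Prime → ∀ (k : Type) [Field k] [CharP k p] (W : Scheme.{0}) [IsIntegral W]
      (f : W ⟶ Spec (.of k)) [IsSeparated f] [LocallyOfFiniteType f] [QuasiCompact f],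
      Scheme.IsRegular W → ∀ g₀ : W.functionField, (∀ c : W.functionField, c ^ p ≠ g₀) →
      ∃ (V : Scheme.{0}) (π : V ⟶ W) (_ : IsIntegral V) (_ : IsDominant π),
        IsProper π ∧ IsBirational π ∧ Scheme.IsRegular V ∧
        ∀ v : V, ∃ c : Fin p → W.functionField, (∃ j : Fin p, (j : ℕ) ≠ 0 ∧ c j ≠ 0) ∧
          ((∃ (d m : ℕ) (hmd : m ≤ d) (t : Fin d → V.presheaf.stalk v) (a : Fin m → ℕ)
              (u : V.presheaf.stalk v), IsUnit u ∧
              Ideal.span (Set.range t) = IsLocalRing.maximalIdeal (V.presheaf.stalk v) ∧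
              ringKrullDim (V.presheaf.stalk v) = (d : WithBot ℕ∞) ∧ 0 < m ∧ (∀ i, ¬ p ∣ a i) ∧
              RatFn.functionFieldMap π (∑ j : Fin p, c j ^ p * g₀ ^ (j : ℕ)) =
                algebraMap (V.presheaf.stalk v) V.functionField
                  (u * ∏ i : Fin m, t (Fin.castLE hmd i) ^ (a i))) ∨
            (∃ u : V.presheaf.stalk v, IsUnit u ∧
              RatFn.functionFieldMap π (∑ j : Fin p, c j ^ p * g₀ ^ (j : ℕ)) =
                algebraMap (V.presheaf.stalk v) V.functionField u ∧
              ∀ c' : V.presheaf.stalk v,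
                u - c' ^ p ∉ IsLocalRing.maximalIdeal (V.presheaf.stalk v)) ∨
            (∃ s c' : V.presheaf.stalk v,
              RatFn.functionFieldMap π (∑ j : Fin p, c j ^ p * g₀ ^ (j : ℕ)) =
                algebraMap (V.presheaf.stalk v) V.functionField s ∧
              s - c' ^ p ∈ IsLocalRing.maximalIdeal (V.presheaf.stalk v) ∧
              s - c' ^ p ∉ IsLocalRing.maximalIdeal (V.presheaf.stalk v) ^ 2))) :
    Summit.ResolutionOfSingularities.ResolutionOfSingularities.Theses.RadicialJung.CleanModels := by
  intro p hp k _ _ W _ f L _ _ hsep hloc hqc hWreg hPI hdeg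
  haveI := hsep; haveI := hloc; haveI := hqc
  haveI : CharP W.functionField p := charP_stalk W f _
  -- a generator of `L/K(W)`
  obtain ⟨-, y₀, g₀, hy₀, hg₀, hg₀p⟩ :=
    stub_generator (K := W.functionField) (L := L) p hp hdeg
  -- the loosely clean model
  obtain ⟨V, π, hVint, hπdom, hπprop, hπbir, hVreg, hclean⟩ := h p hp k W f hWreg g₀ hg₀p
  refine ⟨V, π, hVint, hπdom, hπprop, hπbir, hVreg, fun v => ?_⟩
  obtain ⟨c, ⟨j₀, hj₀, hc⟩, hloose⟩ := hclean v
  haveI : CharP (V.presheaf.stalk v) p := charP_stalk V (π ≫ f) v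
  -- normalise the loose form at `v`
  obtain ⟨ε, δ, hε, hδ, hexact⟩ := stub_pointwiseTransfer (O := V.presheaf.stalk v)
    (K := V.functionField) p hp (RatFn.functionFieldMap π (∑ j : Fin p, c j ^ p * g₀ ^ (j : ℕ)))
    hloose
  -- `π^♯ : K(W) ≅ K(V)`
  have hbij : Function.Bijective (RatFn.functionFieldMap π) := by
    obtain ⟨U, hU, hU', hiso⟩ := hπbir
    haveI := hiso
    exact RatFn.functionFieldMap_bijective_of_isIso_morphismRestrict π U hU hU'
  let e : W.functionField ≃+* V.functionField := RingEquiv.ofBijective _ hbij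
  have he : ∀ x, e x = RatFn.functionFieldMap π x := fun _ => rfl
  -- the unit `ε`, read in `K(W)`
  set ε' : W.functionField := e.symm (algebraMap (V.presheaf.stalk v) V.functionField ε) with hε'def
  have heε' : RatFn.functionFieldMap π ε' = algebraMap (V.presheaf.stalk v) V.functionField ε := by
    rw [← he, hε'def, RingEquiv.apply_symm_apply]
  have hε' : ε' ≠ 0 := by
    intro h0
    have h1 : algebraMap (V.presheaf.stalk v) V.functionField ε = 0 := by
      rw [← heε', h0, map_zero]
    exact (hε.map (algebraMap (V.presheaf.stalk v) V.functionField)).ne_zero h1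
  -- the twisted representative is a `p`-th power of an element of `L ∖ K(W)`
  obtain ⟨y, hy, hyp⟩ :=
    stub_frobeniusTwist (K := W.functionField) (L := L) p hp y₀ g₀ hy₀ hg₀ c j₀ hj₀ hc ε' hε' δ hδ
  refine ⟨y, ε' ^ p * (∑ j : Fin p, c j ^ p * g₀ ^ (j : ℕ)) + δ, hy, hyp, ?_⟩
  have hmap : RatFn.functionFieldMap π (ε' ^ p * (∑ j : Fin p, c j ^ p * g₀ ^ (j : ℕ)) + δ) =
      algebraMap (V.presheaf.stalk v) V.functionField ε ^ p *
        RatFn.functionFieldMap π (∑ j : Fin p, c j ^ p * g₀ ^ (j : ℕ)) + δ := by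
    rw [map_add, map_mul, map_pow, heε', map_natCast]
  rw [hmap]
  exact hexact

/-! ## Calibration: the crux in dimension `≤ 1` (no blow-up needed) -/

/-- **`CleanModels` in dimension `≤ 1`, with `V = W`.** For a regular integral separated curve (or
point) `W` of finite type over a field of characteristic `p` and `L/K(W)` purely inseparable of
degree `p`, `W` itself is pointwise (exactly) log-clean: at the generic point any generator works
(regular type (i) in the field `K(W)`), at a closed point `stub_dvrClean` applies to the DVR
`𝒪_{W,w}` (finiteness of its normalisation in `L`: `stub_curveStalks`), and the loose form is
normalised by `stub_pointwiseTransfer`. -/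
theorem cleanModels_dim_le_one (p : ℕ) (hp : p.Prime) (k : Type) [Field k] [CharP k p]
    (W : Scheme.{0}) [IsIntegral W] (f : W ⟶ Spec (.of k)) (L : Type) [Field L]
    [Algebra W.functionField L] (_hsep : IsSeparated f) (hloc : LocallyOfFiniteType f)
    (_hqc : QuasiCompact f) (hWreg : Scheme.IsRegular W)
    (hPI : IsPurelyInseparable W.functionField L) (hdeg : Module.finrank W.functionField L = p)
    (hdim : topologicalKrullDim W ≤ 1) :
    ∃ (V : Scheme.{0}) (π : V ⟶ W) (_ : IsIntegral V) (_ : IsDominant π),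
      IsProper π ∧ IsBirational π ∧ Scheme.IsRegular V ∧
      (∀ v : V, (∃ (y : L) (g : W.functionField), y ∉ Set.range (algebraMap W.functionField L) ∧
        algebraMap W.functionField L g = y ^ p ∧
        ((∃ (d m : ℕ) (hmd : m ≤ d) (t : Fin d → V.presheaf.stalk v) (a : Fin m → ℕ),
            Ideal.span (Set.range t) = IsLocalRing.maximalIdeal (V.presheaf.stalk v) ∧
            ringKrullDim (V.presheaf.stalk v) = (d : WithBot ℕ∞) ∧ 0 < m ∧ (∀ i, ¬ p ∣ a i) ∧
            RatFn.functionFieldMap π g = ∏ i : Fin m,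
              (algebraMap (V.presheaf.stalk v) V.functionField (t (Fin.castLE hmd i))) ^ (a i)) ∨
          (∃ u₀ : V.presheaf.stalk v, IsUnit u₀ ∧
            RatFn.functionFieldMap π g = algebraMap (V.presheaf.stalk v) V.functionField u₀ ∧
            ((∀ c : V.presheaf.stalk v,
                u₀ - c ^ p ∉ IsLocalRing.maximalIdeal (V.presheaf.stalk v)) ∨
              (∃ c : V.presheaf.stalk v,
                u₀ - c ^ p ∈ IsLocalRing.maximalIdeal (V.presheaf.stalk v) ∧
                u₀ - c ^ p ∉ IsLocalRing.maximalIdeal (V.presheaf.stalk v) ^ 2)))))) := by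
  haveI := hloc; haveI := hPI
  haveI : CharP W.functionField p := charP_stalk W f _
  haveI : FiniteDimensional W.functionField L :=
    Module.finite_of_finrank_pos (by rw [hdeg]; exact hp.pos)
  haveI : CharP L p := charP_of_injective_algebraMap (algebraMap W.functionField L).injective p
  obtain ⟨hLp, y₀, g₀, hy₀, hg₀, hg₀p⟩ :=
    stub_generator (K := W.functionField) (L := L) p hp hdeg
  refine ⟨W, 𝟙 W, inferInstance, inferInstance, inferInstance, isBirational_id W, hWreg, fun w => ?_⟩
  haveI : CharP (W.presheaf.stalk w) p := charP_stalk W f w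
  -- `L` as an `𝒪_{W,w}`-algebra through `K(W)`
  letI : Algebra (W.presheaf.stalk w) L :=
    ((algebraMap W.functionField L).comp (algebraMap (W.presheaf.stalk w) W.functionField)).toAlgebra
  haveI : IsScalarTower (W.presheaf.stalk w) W.functionField L :=
    IsScalarTower.of_algebraMap_eq (fun a => rfl)
  -- a loosely clean representative at `w`, read in `K(W)`: `g` with `π^* g = g`
  have key : ∃ (y : L) (g : W.functionField), y ∉ Set.range (algebraMap W.functionField L) ∧
      algebraMap W.functionField L g = y ^ p ∧
      ((∃ u : W.presheaf.stalk w, IsUnit u ∧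
          g = algebraMap (W.presheaf.stalk w) W.functionField u ∧
          ∀ c : W.presheaf.stalk w, u - c ^ p ∉ IsLocalRing.maximalIdeal (W.presheaf.stalk w)) ∨
        (∃ s c : W.presheaf.stalk w, g = algebraMap (W.presheaf.stalk w) W.functionField s ∧
          s - c ^ p ∈ IsLocalRing.maximalIdeal (W.presheaf.stalk w) ∧
          s - c ^ p ∉ IsLocalRing.maximalIdeal (W.presheaf.stalk w) ^ 2)) := by
    rcases stub_curveStalks W f hWreg hdim L w with hfield | ⟨hdvr, hfin⟩
    · -- generic point: the stalk is the function field, any generator is of type (i)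
      have hsurj : Function.Surjective (algebraMap (W.presheaf.stalk w) W.functionField) := by
        letI := hfield.toField
        exact IsFractionRing.surjective_iff_isField.mpr hfield
          |> fun h => h
      obtain ⟨u, hu⟩ := hsurj g₀
      have hg₀ne : g₀ ≠ 0 := by
        intro h0; exact hg₀p 0 (by rw [h0, zero_pow hp.ne_zero])
      have huunit : IsUnit u := by
        letI := hfield.toField
        exact isUnit_iff_ne_zero.mpr (by rintro rfl; exact hg₀ne (by rw [← hu, map_zero]))
      refine ⟨y₀, g₀, hy₀, hg₀, Or.inl ⟨u, huunit, hu.symm, fun c hc => ?_⟩⟩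
      have hmax : IsLocalRing.maximalIdeal (W.presheaf.stalk w) = ⊥ :=
        IsLocalRing.isField_iff_maximalIdeal_eq.mp hfield
      rw [hmax, Ideal.mem_bot, sub_eq_zero] at hc
      exact hg₀p (algebraMap _ _ c) (by rw [← map_pow, ← hc, hu])
    · -- closed point: DVR cleaning
      haveI := hdvr
      obtain ⟨hB, hBp, hBK⟩ := stub_dvrNormalization (O := W.presheaf.stalk w)
        (K := W.functionField) (L := L) p hp hLp ⟨y₀, hy₀⟩ hfin
      obtain ⟨y, s, hy, hys, hcase⟩ := stub_dvrClean (O := W.presheaf.stalk w)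
        (K := W.functionField) (L := L) p hp hB hBp hBK hfin
      refine ⟨y, algebraMap (W.presheaf.stalk w) W.functionField s, hy, ?_, ?_⟩
      · rw [← hys]; rfl
      · rcases hcase with ⟨hs1, hs2⟩ | ⟨hsu, hsc⟩
        · exact Or.inr ⟨s, 0, rfl, by rw [zero_pow hp.ne_zero, sub_zero]; exact hs1,
            by rw [zero_pow hp.ne_zero, sub_zero]; exact hs2⟩
        · exact Or.inl ⟨s, hsu, rfl, hsc⟩
  obtain ⟨y, g, hy, hyg, hloose⟩ := key
  -- normalise (only the shift `g ↦ g + 1` can occur; `ε` is returned anyway)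
  have hloose' := stub_pointwiseTransfer (O := W.presheaf.stalk w) (K := W.functionField) p hp g
    (Or.inr hloose)
  obtain ⟨ε, δ, hε, hδ, hexact⟩ := hloose'
  -- twist `y` accordingly: `y' = ε y + δ`
  set ε' : W.functionField := algebraMap (W.presheaf.stalk w) W.functionField ε with hε'def
  have hε' : ε' ≠ 0 := (hε.map (algebraMap (W.presheaf.stalk w) W.functionField)).ne_zero
  refine ⟨algebraMap W.functionField L ε' * y + δ, ε' ^ p * g + δ, ?_, ?_, ?_⟩
  · rintro ⟨x, hx⟩
    apply hy
    refine ⟨(x - δ) / ε', ?_⟩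
    rw [map_div₀, map_sub, hx, map_natCast, add_sub_cancel_right, mul_div_cancel_left₀]
    exact (map_ne_zero _).mpr hε'
  · haveI : Fact p.Prime := ⟨hp⟩
    rw [map_add, map_mul, map_pow, hyg, map_natCast, add_pow_char, mul_pow]
    congr 1
    have : ((δ : L)) ^ p = δ := by
      interval_cases δ <;> simp [hp.ne_zero]
    exact this.symm
  · rw [RatFn.functionFieldMap_id]
    simpa using hexact

end Summit.ResolutionOfSingularities.ResolutionOfSingularities.Theorems.RadicialJung.CleanModels

end
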